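import Literature.NumberTheory.Sieve.LinearEquationsInPrimes
import Mathlib.Analysis.SpecialFunctions.Log.Summable
import Mathlib.Analysis.PSeries
import Mathlib.GroupTheory.Index
import Mathlib.Algebra.Field.ZMod
import Mathlib.Algebra.Order.Ring.Pow
import HarnessLib

/-!
# Linear equations in primes: convergence of the singular product (Green–Tao 2010, Lemma 1.3)

Trunk T-SIEVE. This file discharges the named fact `Literature.NumberTheory.Sieve.tendsto_singularProductPartial` of
`Literature/NumberTheory/Sieve/LinearEquationsInPrimes.lean`:
for a system `Ψ = (ψ₁, …, ψ_t)` of affine-linear forms on `ℤ^d` satisfying Green–Tao's standing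
hypotheses (`IsNondegenerateSystem`: every `ψ̇ᵢ ≠ 0`, no two forms rational multiples of each
other) the ordered partial products `∏_{p ≤ x} β_p` of the local factors (1.6) converge.

We follow the printed proof of B. Green, T. Tao, *Linear equations in primes*, Ann. of Math. 171
(2010), Lemma 1.3 (= Lemma 3, p. 4 of arXiv:math/0606088) and the sentence after it ("In
particular we see that the singular series `∏_p β_p` is always convergent"):

* (`localFactor_prime`) for a prime `p`,
  `β_p = (p/(p-1))^t · #{n ∈ (ℤ/p)^d : p ∤ ψ₁(n) ⋯ ψ_t(n)} / p^d`;
* (`card_modZero_mul`, `card_modZero_pair_mul`, "elementary linear algebra") if `ψ̇ᵢ ≢ 0 (mod p)`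
  then `#{n : ψᵢ(n) ≡ 0} = p^{d-1}`, and for `p` large (depending on `Ψ`) two distinct forms
  vanish simultaneously on at most `p^{d-2}` points — either some `2 × 2` minor of `(ψ̇ᵢ, ψ̇ⱼ)`
  is prime to `p` (fibres of a surjective homomorphism onto `(ℤ/p)²`), or `ψ̇ᵢ ∥ ψ̇ⱼ` over `ℤ`
  and then non-degeneracy makes the two congruences incompatible mod `p`;
* (`bonferroni_one`, `bonferroni_two`) the first two Bonferroni inequalities, by double
  counting;
* (`abs_localFactor_sub_one_le`) hence `|β_p - 1| ≤ t²/p²` for all sufficiently large primes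
  `p`, and (`tendsto_singularProductPartial_holds`) `∑_p p⁻² < ∞` gives convergence of the
  product (`multipliable_one_add_of_summable`).

## References

* B. Green, T. Tao, *Linear equations in primes*, Ann. of Math. (2) 171 (2010), 1753–1850
  (arXiv:math/0606088), Lemma 1.3 and (1.5)–(1.7).
-/

noncomputable section

open Filter Finset
open scoped Topology

namespace Literature.NumberTheory.Sieve

variable {d t : ℕ}

/-! ### Reduction of the forms modulo `p` -/

namespace AffLinForm

/-- The reduction of `ψ` modulo `p`: the affine-linear form `n ↦ ∑ⱼ ψ̇(eⱼ) nⱼ + ψ(0)` on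
`(ℤ/pℤ)^d`. [cite: GreenTao2010, proof of Lemma 1.3] -/
def modEval (ψ : AffLinForm d) (p : ℕ) (v : Fin d → ZMod p) : ZMod p :=
  ∑ j, (ψ.coeff j : ZMod p) * v j + (ψ.const : ZMod p)

/-- `ψ(n) mod p = ψ_p(n mod p)`. [folklore] -/
theorem intCast_eval (ψ : AffLinForm d) (p : ℕ) (n : Fin d → ℤ) :
    ((ψ.eval n : ℤ) : ZMod p) = ψ.modEval p (fun j => (n j : ZMod p)) := by
  simp [eval, modEval]

end AffLinForm

/-- The linear functional `v ↦ ∑ⱼ aⱼ vⱼ` on `R^d`, as an additive homomorphism. [folklore] -/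
def dotHom {R : Type*} [CommRing R] (a : Fin d → R) : (Fin d → R) →+ R where
  toFun v := ∑ j, a j * v j
  map_zero' := by simp
  map_add' u v := by simp [mul_add, Finset.sum_add_distrib]

/-- Unfolding `dotHom`. [folklore] -/
@[simp] theorem dotHom_apply {R : Type*} [CommRing R] (a v : Fin d → R) :
    dotHom a v = ∑ j, a j * v j := rfl

/-- `dotHom a eₖx = aₖ x`. [folklore] -/
theorem dotHom_single {R : Type*} [CommRing R] (a : Fin d → R) (k : Fin d) (x : R) :
    dotHom a (Pi.single k x) = a k * x := by
  simp [Pi.single_apply]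

/-- `ψ_p(v) = ψ̇_p · v + ψ(0)`. [folklore] -/
theorem AffLinForm.modEval_eq_dotHom (ψ : AffLinForm d) (p : ℕ) (v : Fin d → ZMod p) :
    ψ.modEval p v = dotHom (fun j => (ψ.coeff j : ZMod p)) v + (ψ.const : ZMod p) := rfl

/-- A non-zero integer is non-zero modulo every `p > |D|`. [folklore] -/
theorem intCast_zmod_ne_zero_of_natAbs_lt {D : ℤ} {p : ℕ} (hD : D ≠ 0) (hp : D.natAbs < p) :
    (D : ZMod p) ≠ 0 := by
  intro h
  rw [ZMod.intCast_zmod_eq_zero_iff_dvd] at h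
  exact hD (Int.eq_zero_of_dvd_of_natAbs_lt_natAbs h (by simpa using hp))

/-! ### The local factor at a prime as a count over `(ℤ/p)^d` -/

/-- For a prime `p`: `Λ_{ℤ/p}(b) = p/(p-1)` if `p ∤ b` and `0` otherwise.
[cite: GreenTao2010, (1.5)] -/
theorem localVonMangoldt_prime {p : ℕ} (hp : p.Prime) (b : ℤ) :
    localVonMangoldt p b = if (b : ZMod p) = 0 then 0 else (p : ℝ) / (p - 1) := by
  have key : Int.gcd b p = 1 ↔ ¬ (b : ZMod p) = 0 := by
    rw [ZMod.intCast_zmod_eq_zero_iff_dvd, Int.natCast_dvd, ← hp.coprime_iff_not_dvd,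
      Nat.coprime_comm, Nat.coprime_iff_gcd_eq_one, Int.gcd_eq_natAbs_gcd_natAbs,
      Int.natAbs_natCast]
  unfold localVonMangoldt
  rw [Nat.totient_prime hp, Nat.cast_sub hp.one_le, Nat.cast_one]
  by_cases h : (b : ZMod p) = 0
  · rw [if_pos h, if_neg (fun h1 => key.mp h1 h)]
  · rw [if_neg h, if_pos (key.mpr h)]

/-- For a prime `p`: `∏ᵢ Λ_{ℤ/p}(ψᵢ(n)) = (p/(p-1))^t` if no `ψᵢ(n)` is divisible by `p`, and `0`
otherwise. [cite: GreenTao2010, proof of Lemma 1.3] -/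
theorem prod_localVonMangoldt_prime {p : ℕ} (hp : p.Prime) (Ψ : Fin t → AffLinForm d)
    (n : Fin d → ℤ) :
    ∏ i, localVonMangoldt p ((Ψ i).eval n) =
      if ∀ i, (Ψ i).modEval p (fun j => (n j : ZMod p)) ≠ 0 then ((p : ℝ) / (p - 1)) ^ t
      else 0 := by
  simp_rw [localVonMangoldt_prime hp, AffLinForm.intCast_eval]
  have : ∀ i ∈ (univ : Finset (Fin t)),
      (if (Ψ i).modEval p (fun j => (n j : ZMod p)) = 0 then (0 : ℝ) else (p : ℝ) / (p - 1)) =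
        if (Ψ i).modEval p (fun j => (n j : ZMod p)) ≠ 0 then (p : ℝ) / (p - 1) else 0 :=
    fun i _ => by split_ifs with h1 h2 <;> simp_all
  rw [Finset.prod_congr rfl this, Finset.prod_ite_zero]
  simp only [Finset.prod_const, Finset.card_univ, Fintype.card_fin, ne_eq, Finset.mem_univ,
    forall_const]

/-- Sums over the box of representatives `{0, …, p-1}^d` of a function of the residues are sums
over `(ℤ/p)^d`. [folklore] -/
theorem sum_piFinset_range_eq_sum_zmod {M : Type*} [AddCommMonoid M] (p : ℕ) [NeZero p]
    (F : (Fin d → ZMod p) → M) :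
    ∑ n ∈ Fintype.piFinset (fun _ : Fin d => range p), F (fun j => (n j : ZMod p)) =
      ∑ v : Fin d → ZMod p, F v := by
  refine Finset.sum_nbij' (fun n j => (n j : ZMod p)) (fun v j => (v j).val) (by simp) ?_ ?_ ?_
    (by simp)
  · intro v _
    exact Finset.mem_coe.mpr (Fintype.mem_piFinset.mpr fun j => mem_range.mpr (ZMod.val_lt (v j)))
  · intro n hn
    funext j
    have := mem_range.mp (Fintype.mem_piFinset.mp (Finset.mem_coe.mp hn) j)
    simp [ZMod.val_natCast, Nat.mod_eq_of_lt this]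
  · intro v _
    funext j
    simp

/-- `#{n ∈ (ℤ/p)^d : ψ₁(n), …, ψ_t(n) ≢ 0 (mod p)}`. [cite: GreenTao2010, proof of Lemma 1.3] -/
def goodCount (Ψ : Fin t → AffLinForm d) (p : ℕ) [NeZero p] : ℕ :=
  #{v : Fin d → ZMod p | ∀ i, ¬ (Ψ i).modEval p v = 0}

/-- For a prime `p`, `β_p = p^{-d} · (p/(p-1))^t · #{n ∈ (ℤ/p)^d : p ∤ ψ₁(n) ⋯ ψ_t(n)}`
("the product in (1.6) is equal to `(p/(p-1))^t` with probability … and zero otherwise").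
[cite: GreenTao2010, proof of Lemma 1.3] -/
theorem localFactor_prime {p : ℕ} [hp : Fact p.Prime] (Ψ : Fin t → AffLinForm d) :
    localFactor Ψ p = ((p : ℝ) ^ d)⁻¹ * (((p : ℝ) / (p - 1)) ^ t * goodCount Ψ p) := by
  unfold localFactor
  congr 1
  let F : (Fin d → ZMod p) → ℝ := fun v =>
    if ∀ i, ¬ (Ψ i).modEval p v = 0 then ((p : ℝ) / (p - 1)) ^ t else 0
  have h1 : ∀ n ∈ Fintype.piFinset (fun _ : Fin d => range p),
      ∏ i, localVonMangoldt p ((Ψ i).eval fun j => (n j : ℤ)) =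
        F (fun j => ((n j : ℕ) : ZMod p)) := by
    intro n _
    rw [prod_localVonMangoldt_prime hp.out]
    simp only [Int.cast_natCast, ne_eq, F]
  rw [Finset.sum_congr rfl h1, sum_piFinset_range_eq_sum_zmod p F]
  simp only [F]
  rw [← Finset.sum_filter, Finset.sum_const, nsmul_eq_mul, mul_comm]
  rfl

/-! ### Counting zeros of one and of two forms modulo `p` -/

/-- The fibres of a surjective homomorphism of finite abelian groups all have cardinality
`|G| / |H|`. [folklore] -/
theorem card_fiber_mul_card_of_surjective {G H : Type*} [AddCommGroup G] [Fintype G]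
    [AddCommGroup H] [Fintype H] [DecidableEq H] (f : G →+ H) (hf : Function.Surjective f)
    (y : H) : #{g | f g = y} * Fintype.card H = Fintype.card G := by
  have h := Finset.card_eq_sum_card_fiberwise (f := f) (s := (univ : Finset G))
    (t := (univ : Finset H)) (fun x _ => by simp)
  rw [Finset.sum_congr rfl (fun b _ => AddMonoidHom.card_fiber_eq_of_mem_range f
    (Set.mem_range.mpr (hf b)) (Set.mem_range.mpr (hf y))), Finset.sum_const, smul_eq_mul,
    Finset.card_univ, Finset.card_univ] at h
  rw [h, mul_comm]

/-- `|(ℤ/p)^d| = p^d`. [folklore] -/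
theorem card_zmod_pow (p d : ℕ) [NeZero p] : Fintype.card (Fin d → ZMod p) = p ^ d := by
  simp [ZMod.card]

/-- If `ψ̇ ≢ 0 (mod p)` then `ψ ≡ 0 (mod p)` on exactly `p^{d-1}` points of `(ℤ/p)^d`.
[cite: GreenTao2010, proof of Lemma 1.3] -/
theorem card_modZero_mul {p : ℕ} [Fact p.Prime] (ψ : AffLinForm d)
    (hψ : (fun j => (ψ.coeff j : ZMod p)) ≠ 0) :
    #{v : Fin d → ZMod p | ψ.modEval p v = 0} * p = p ^ d := by
  obtain ⟨k, hk⟩ : ∃ k, (ψ.coeff k : ZMod p) ≠ 0 := by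
    by_contra h
    push Not at h
    exact hψ (funext h)
  set a : Fin d → ZMod p := fun j => (ψ.coeff j : ZMod p) with ha
  have hsurj : Function.Surjective (dotHom a) := fun y =>
    ⟨Pi.single k ((a k)⁻¹ * y), by rw [dotHom_single, ← mul_assoc, mul_inv_cancel₀ hk, one_mul]⟩
  have h := card_fiber_mul_card_of_surjective (dotHom a) hsurj (-(ψ.const : ZMod p))
  rw [ZMod.card, card_zmod_pow] at h
  rw [← h]
  congr 2
  refine Finset.filter_congr fun v _ => ?_
  rw [AffLinForm.modEval_eq_dotHom, add_eq_zero_iff_eq_neg]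

/-- If some `2 × 2` minor of `(ψ̇, φ̇)` is `≢ 0 (mod p)` then `ψ ≡ φ ≡ 0 (mod p)` on exactly
`p^{d-2}` points of `(ℤ/p)^d`. [cite: GreenTao2010, proof of Lemma 1.3] -/
theorem card_modZero_pair_mul {p : ℕ} [Fact p.Prime] (ψ φ : AffLinForm d) (k l : Fin d)
    (hD : ((ψ.coeff k * φ.coeff l - ψ.coeff l * φ.coeff k : ℤ) : ZMod p) ≠ 0) :
    #{v : Fin d → ZMod p | ψ.modEval p v = 0 ∧ φ.modEval p v = 0} * p ^ 2 = p ^ d := by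
  set a : Fin d → ZMod p := fun j => (ψ.coeff j : ZMod p) with ha
  set b : Fin d → ZMod p := fun j => (φ.coeff j : ZMod p) with hb
  set D : ZMod p := a k * b l - a l * b k with hDdef
  have hD' : D ≠ 0 := by
    simp only [hDdef, ha, hb]
    push_cast at hD
    exact hD
  have hkl : k ≠ l := by
    rintro rfl
    exact hD' (by rw [hDdef]; ring)
  have hsurj : Function.Surjective ((dotHom a).prod (dotHom b)) := by
    rintro ⟨y, z⟩
    refine ⟨(Pi.single k (D⁻¹ * (y * b l - z * a l)) : Fin d → ZMod p) +
      Pi.single l (D⁻¹ * (z * a k - y * b k)), ?_⟩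
    simp only [AddMonoidHom.prod_apply, map_add, dotHom_single, Prod.mk_add_mk, Prod.mk.injEq]
    constructor
    · calc _ = D⁻¹ * D * y := by rw [hDdef]; ring
        _ = y := by rw [inv_mul_cancel₀ hD', one_mul]
    · calc _ = D⁻¹ * D * z := by rw [hDdef]; ring
        _ = z := by rw [inv_mul_cancel₀ hD', one_mul]
  have h := card_fiber_mul_card_of_surjective _ hsurj (-(ψ.const : ZMod p), -(φ.const : ZMod p))
  rw [Fintype.card_prod, ZMod.card, card_zmod_pow, ← sq] at h
  rw [← h]
  congr 2
  refine Finset.filter_congr fun v _ => ?_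
  rw [AffLinForm.modEval_eq_dotHom, AffLinForm.modEval_eq_dotHom, add_eq_zero_iff_eq_neg,
    add_eq_zero_iff_eq_neg, AddMonoidHom.prod_apply, Prod.mk.injEq]

/-- If `a'φ̇ = b'ψ̇` over `ℤ` but `a'φ(0) - b'ψ(0) ≢ 0 (mod p)`, then `ψ` and `φ` have no common
zero mod `p`. [cite: GreenTao2010, proof of Lemma 1.3] -/
theorem filter_modZero_pair_eq_empty {p : ℕ} [NeZero p] (ψ φ : AffLinForm d) (a' b' : ℤ)
    (hab : ∀ j, a' * φ.coeff j = b' * ψ.coeff j)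
    (hE : ((a' * φ.const - b' * ψ.const : ℤ) : ZMod p) ≠ 0) :
    ({v : Fin d → ZMod p | ψ.modEval p v = 0 ∧ φ.modEval p v = 0} : Finset _) = ∅ := by
  refine Finset.filter_eq_empty_iff.mpr ?_
  rintro v - ⟨h1, h2⟩
  apply hE
  have key : (a' : ZMod p) * φ.modEval p v - (b' : ZMod p) * ψ.modEval p v =
      ((a' * φ.const - b' * ψ.const : ℤ) : ZMod p) := by
    have hab' : ∀ j, (a' : ZMod p) * (φ.coeff j : ZMod p) = (b' : ZMod p) * (ψ.coeff j : ZMod p) :=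
      fun j => by rw [← Int.cast_mul, ← Int.cast_mul, hab j]
    simp only [AffLinForm.modEval, mul_add, Finset.mul_sum, ← mul_assoc, hab']
    push_cast
    ring
  rw [← key, h1, h2]
  ring

/-- For every form of a non-degenerate system, eventually in the prime `p`:
`#{n : ψᵢ(n) ≡ 0} · p = p^d`. [cite: GreenTao2010, proof of Lemma 1.3] -/
theorem eventually_card_modZero (Ψ : Fin t → AffLinForm d) (hΨ : IsNondegenerateSystem Ψ)
    (i : Fin t) :
    ∀ᶠ p : ℕ in atTop, ∀ [Fact p.Prime],
      #{v : Fin d → ZMod p | (Ψ i).modEval p v = 0} * p = p ^ d := by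
  obtain ⟨k, hk⟩ : ∃ k, (Ψ i).coeff k ≠ 0 := by
    by_contra h
    push Not at h
    exact hΨ.1 i (funext h)
  filter_upwards [eventually_gt_atTop ((Ψ i).coeff k).natAbs] with p hp hprime
  exact card_modZero_mul (Ψ i)
    (fun h => intCast_zmod_ne_zero_of_natAbs_lt hk hp (congr_fun h k))

/-- For every pair of distinct forms of a non-degenerate system, eventually in the prime `p`:
`#{n : ψᵢ(n) ≡ ψⱼ(n) ≡ 0} · p² ≤ p^d` ("`ψᵢ` and `ψⱼ` cannot be linear multiples of each other
modulo `p`"). [cite: GreenTao2010, proof of Lemma 1.3] -/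
theorem eventually_card_modZero_pair_le (Ψ : Fin t → AffLinForm d) (hΨ : IsNondegenerateSystem Ψ)
    {i j : Fin t} (hij : i ≠ j) :
    ∀ᶠ p : ℕ in atTop, ∀ [Fact p.Prime],
      #{v : Fin d → ZMod p | (Ψ i).modEval p v = 0 ∧ (Ψ j).modEval p v = 0} * p ^ 2 ≤ p ^ d := by
  by_cases hcase : ∃ k l, (Ψ i).coeff k * (Ψ j).coeff l - (Ψ i).coeff l * (Ψ j).coeff k ≠ 0
  · obtain ⟨k, l, hD⟩ := hcase
    filter_upwards [eventually_gt_atTop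
      ((Ψ i).coeff k * (Ψ j).coeff l - (Ψ i).coeff l * (Ψ j).coeff k).natAbs] with p hp hprime
    exact (card_modZero_pair_mul (Ψ i) (Ψ j) k l (intCast_zmod_ne_zero_of_natAbs_lt hD hp)).le
  · push Not at hcase
    obtain ⟨k₀, hk₀⟩ : ∃ k, (Ψ i).coeff k ≠ 0 := by
      by_contra h
      push Not at h
      exact hΨ.1 i (funext h)
    set a' := (Ψ i).coeff k₀ with ha'
    set b' := (Ψ j).coeff k₀ with hb'
    have hab : ∀ l, a' * (Ψ j).coeff l = b' * (Ψ i).coeff l := fun l => by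
      have := hcase k₀ l
      rw [hb']
      linarith
    have hE : a' * (Ψ j).const - b' * (Ψ i).const ≠ 0 := by
      intro hE
      refine hk₀ (hΨ.2 i j hij b' a' (fun n => ?_)).2
      simp only [AffLinForm.eval, mul_add, Finset.mul_sum, ← mul_assoc]
      rw [show b' * (Ψ i).const = a' * (Ψ j).const by linarith]
      congr 1
      exact Finset.sum_congr rfl fun l _ => by rw [hab l]
    filter_upwards [eventually_gt_atTop (a' * (Ψ j).const - b' * (Ψ i).const).natAbs]
      with p hp hprime
    rw [filter_modZero_pair_eq_empty (Ψ i) (Ψ j) a' b' hab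
      (intCast_zmod_ne_zero_of_natAbs_lt hE hp), Finset.card_empty, zero_mul]
    exact Nat.zero_le _

/-! ### The first two Bonferroni inequalities -/

section Bonferroni

variable {V ι : Type*} [Fintype V] [Fintype ι] (Z : ι → V → Prop) [∀ i, DecidablePred (Z i)]

/-- Double counting: `∑ᵢ #Sᵢ = ∑_v m(v)` where `m(v) = #{i : v ∈ Sᵢ}`. [folklore] -/
theorem sum_card_filter_comm : ∑ i, #{v | Z i v} = ∑ v, #{i | Z i v} := by
  simp only [Finset.card_filter]
  exact Finset.sum_comm

/-- Double counting: `∑_{i ≠ j} #(Sᵢ ∩ Sⱼ) + ∑ᵢ #Sᵢ = ∑_v m(v)²`. [folklore] -/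
theorem sum_card_filter_pair_add [DecidableEq ι] :
    ∑ ij ∈ (univ : Finset ι).offDiag, #{v | Z ij.1 v ∧ Z ij.2 v} + ∑ i, #{v | Z i v} =
      ∑ v, #{i | Z i v} * #{i | Z i v} := by
  have h : ∀ v, #{ij ∈ (univ : Finset ι).offDiag | Z ij.1 v ∧ Z ij.2 v} =
      #{i | Z i v} * #{i | Z i v} - #{i | Z i v} := by
    intro v
    rw [← Finset.offDiag_card]
    congr 1
    ext ⟨i, j⟩
    simp only [Finset.mem_filter, Finset.mem_offDiag, Finset.mem_univ, true_and]
    tauto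
  calc ∑ ij ∈ (univ : Finset ι).offDiag, #{v | Z ij.1 v ∧ Z ij.2 v} + ∑ i, #{v | Z i v}
      = ∑ v, #{ij ∈ (univ : Finset ι).offDiag | Z ij.1 v ∧ Z ij.2 v} + ∑ v, #{i | Z i v} := by
        congr 1
        · simp only [Finset.card_filter]
          exact Finset.sum_comm
        · exact sum_card_filter_comm Z
    _ = ∑ v, (#{ij ∈ (univ : Finset ι).offDiag | Z ij.1 v ∧ Z ij.2 v} + #{i | Z i v}) :=
        Finset.sum_add_distrib.symm
    _ = _ := Finset.sum_congr rfl fun v _ => by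
        rw [h v, Nat.sub_add_cancel (Nat.le_mul_self _)]

/-- `#(⋃ᵢ Sᵢ) = #{v : m(v) ≠ 0}`. [folklore] -/
theorem card_filter_exists_eq :
    #{v | ∃ i, Z i v} = ∑ v, if #{i | Z i v} = 0 then 0 else 1 := by
  rw [Finset.card_filter]
  refine Finset.sum_congr rfl fun v _ => ?_
  have hiff : (∃ i, Z i v) ↔ ¬ #{i | Z i v} = 0 := by
    rw [Finset.card_eq_zero, Finset.filter_eq_empty_iff]
    simp
  by_cases h : ∃ i, Z i v
  · rw [if_pos h, if_neg (hiff.mp h)]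
  · rw [if_neg h, if_pos (not_not.mp (mt hiff.mpr h))]

/-- First Bonferroni inequality `#(⋃ᵢ Sᵢ) ≤ ∑ᵢ #Sᵢ`. [folklore] -/
theorem bonferroni_one : #{v | ∃ i, Z i v} ≤ ∑ i, #{v | Z i v} := by
  rw [card_filter_exists_eq, sum_card_filter_comm]
  exact Finset.sum_le_sum fun v _ => by split_ifs <;> omega

/-- Second Bonferroni inequality `∑ᵢ #Sᵢ - ½ ∑_{i ≠ j} #(Sᵢ ∩ Sⱼ) ≤ #(⋃ᵢ Sᵢ)` (ordered pairs).
[folklore] -/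
theorem bonferroni_two [DecidableEq ι] :
    2 * ∑ i, #{v | Z i v} ≤
      2 * #{v | ∃ i, Z i v} + ∑ ij ∈ (univ : Finset ι).offDiag, #{v | Z ij.1 v ∧ Z ij.2 v} := by
  have h3 := sum_card_filter_pair_add Z
  suffices 3 * ∑ i, #{v | Z i v} ≤ 2 * #{v | ∃ i, Z i v} + ∑ v, #{i | Z i v} * #{i | Z i v} by
    omega
  rw [card_filter_exists_eq, sum_card_filter_comm, Finset.mul_sum, Finset.mul_sum,
    ← Finset.sum_add_distrib]
  refine Finset.sum_le_sum fun v _ => ?_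
  generalize #{i | Z i v} = m
  rcases m with _ | _ | _ | m
  · simp
  · simp
  · simp
  · rw [if_neg (by omega)]
    nlinarith

/-- `#{v : v ∉ Sᵢ ∀ i} + #(⋃ᵢ Sᵢ) = #V`. [folklore] -/
theorem card_filter_forall_not_add [DecidablePred fun v => ∀ i, ¬ Z i v] :
    #{v | ∀ i, ¬ Z i v} + #{v | ∃ i, Z i v} = Fintype.card V := by
  have : ({v | ∀ i, ¬ Z i v} : Finset V) = ({v | ¬ ∃ i, Z i v} : Finset V) := by
    ext v
    simp
  rw [this, add_comm, Finset.card_filter_add_card_filter_not, Finset.card_univ]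

end Bonferroni

/-! ### The estimate `β_p = 1 + O(p⁻²)` -/

/-- `(1 - q)^t ≤ 1 - tq + (t choose 2) q²` for `0 ≤ q ≤ 1` (Bonferroni for independent events).
[folklore] -/
theorem one_sub_pow_le_bonferroni {q : ℝ} (hq : 0 ≤ q) (hq1 : q ≤ 1) (t : ℕ) :
    (1 - q) ^ t ≤ 1 - t * q + ((t : ℝ) * t - t) / 2 * q ^ 2 := by
  induction t with
  | zero => simp
  | succ n ih =>
    have h1 : 0 ≤ 1 - q := by linarith
    have hn : (0 : ℝ) ≤ (n : ℝ) * n - n := by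
      have := (Nat.cast_le (α := ℝ)).mpr (Nat.le_mul_self n)
      push_cast at this
      linarith
    calc (1 - q) ^ (n + 1) = (1 - q) ^ n * (1 - q) := pow_succ _ _
      _ ≤ (1 - n * q + ((n : ℝ) * n - n) / 2 * q ^ 2) * (1 - q) :=
        mul_le_mul_of_nonneg_right ih h1
      _ = 1 - (↑(n + 1) : ℝ) * q + ((↑(n + 1) : ℝ) * ↑(n + 1) - ↑(n + 1)) / 2 * q ^ 2
            - ((n : ℝ) * n - n) / 2 * q ^ 3 := by push_cast; ring
      _ ≤ _ := by nlinarith [mul_nonneg hn (pow_nonneg hq 3)]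

/-- If `x, y ∈ [L, L + E]` with `L ≥ ½` then `|x/y - 1| ≤ 2E`. [folklore] -/
theorem abs_div_sub_one_le {x y L E : ℝ} (hx : L ≤ x) (hx' : x ≤ L + E) (hy : L ≤ y)
    (hy' : y ≤ L + E) (hL : 1 / 2 ≤ L) : |x / y - 1| ≤ 2 * E := by
  have hy0 : 0 < y := by linarith
  have hE : 0 ≤ E := by linarith
  rw [div_sub_one hy0.ne', abs_div, abs_of_pos hy0, div_le_iff₀ hy0, abs_le]
  constructor <;> nlinarith [mul_nonneg hE (by linarith : (0 : ℝ) ≤ y - 1 / 2)]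

/-- The arithmetic of Lemma 1.3: if `A p = t p^d`, `B p² ≤ t(t-1) p^d`, `p^d ≤ G + A`,
`2A + 2G ≤ 2p^d + B` (the two Bonferroni inequalities for `G = p^d - #⋃Sᵢ`) and `p ≥ 2t`, then
`|p^{-d} (p/(p-1))^t G - 1| ≤ t²/p²`. [cite: GreenTao2010, proof of Lemma 1.3] -/
theorem localFactor_estimate {p d t G A B : ℕ} (hp : 2 ≤ p) (hpt : 2 * t ≤ p)
    (hA : A * p = t * p ^ d) (hB : B * p ^ 2 ≤ (t * t - t) * p ^ d)
    (h1 : p ^ d ≤ G + A) (h2 : 2 * A + 2 * G ≤ 2 * p ^ d + B) :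
    |((p : ℝ) ^ d)⁻¹ * (((p : ℝ) / (p - 1)) ^ t * G) - 1| ≤ (t : ℝ) ^ 2 / (p : ℝ) ^ 2 := by
  have hp0 : (0 : ℝ) < p := by exact_mod_cast (by omega : 0 < p)
  have hp2 : (2 : ℝ) ≤ p := by exact_mod_cast hp
  have hp1 : (p : ℝ) - 1 ≠ 0 := by linarith
  have heq : ((p : ℝ) ^ d)⁻¹ * (((p : ℝ) / (p - 1)) ^ t * G) =
      G / (p : ℝ) ^ d / (1 - ((p : ℝ))⁻¹) ^ t := by
    have h1q : 1 - ((p : ℝ))⁻¹ = (p - 1) / p := by field_simp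
    rw [h1q, div_pow, div_pow]
    field_simp
  have hr : (t : ℝ) ^ 2 / (p : ℝ) ^ 2 = (t : ℝ) ^ 2 * ((p : ℝ)⁻¹) ^ 2 := by
    rw [inv_pow, div_eq_mul_inv]
  rw [heq, hr]
  set P : ℝ := (p : ℝ) ^ d with hPdef
  have hP0 : 0 < P := by positivity
  set q : ℝ := (p : ℝ)⁻¹ with hqdef
  have hq0 : 0 ≤ q := by positivity
  have hq1 : q ≤ 1 := inv_le_one_of_one_le₀ (by linarith)
  have hqt : (t : ℝ) * q ≤ 1 / 2 := by
    rw [hqdef, ← div_eq_mul_inv, div_le_iff₀ hp0]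
    have : ((2 * t : ℕ) : ℝ) ≤ p := by exact_mod_cast hpt
    push_cast at this
    linarith
  have hA' : (A : ℝ) = t * P * q := by
    have h : (A : ℝ) * p = t * P := by rw [hPdef]; exact_mod_cast hA
    rw [hqdef, eq_mul_inv_iff_mul_eq₀ hp0.ne']
    exact h
  have htt : ((t * t - t : ℕ) : ℝ) = (t : ℝ) * t - t := by
    rw [Nat.cast_sub (Nat.le_mul_self t)]
    push_cast
    ring
  have hB' : (B : ℝ) ≤ ((t : ℝ) * t - t) * P * q ^ 2 := by
    have h : (B : ℝ) * (p : ℝ) ^ 2 ≤ ((t : ℝ) * t - t) * P := by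
      rw [hPdef, ← htt]
      exact_mod_cast hB
    rw [hqdef, inv_pow, ← div_eq_mul_inv, le_div_iff₀ (by positivity)]
    exact h
  have h1' : P ≤ G + A := by rw [hPdef]; exact_mod_cast h1
  have h2' : 2 * (A : ℝ) + 2 * G ≤ 2 * P + B := by rw [hPdef]; exact_mod_cast h2
  have hx1 : 1 - t * q ≤ G / P := by
    rw [le_div_iff₀ hP0]
    nlinarith [h1', hA']
  have hx2 : (G : ℝ) / P ≤ 1 - t * q + ((t : ℝ) * t - t) / 2 * q ^ 2 := by
    rw [div_le_iff₀ hP0]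
    nlinarith [h2', hA', hB']
  have hy1 : 1 - t * q ≤ (1 - q) ^ t := by
    have := one_add_mul_le_pow (a := -q) (by linarith) t
    calc 1 - t * q = 1 + t * -q := by ring
      _ ≤ (1 + -q) ^ t := this
      _ = (1 - q) ^ t := by ring
  have hy2 := one_sub_pow_le_bonferroni hq0 hq1 t
  refine (abs_div_sub_one_le hx1 hx2 hy1 hy2 (by linarith)).trans ?_
  nlinarith [mul_nonneg (Nat.cast_nonneg t : (0 : ℝ) ≤ t) (sq_nonneg q)]

/-- **Green–Tao 2010, Lemma 1.3** (for a fixed system): `β_p = 1 + O(p⁻²)`; precisely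
`|β_p - 1| ≤ t²/p²` for every sufficiently large prime `p` (depending on `Ψ`).
[cite: GreenTao2010, Lemma 1.3] -/
theorem abs_localFactor_sub_one_le (Ψ : Fin t → AffLinForm d) (hΨ : IsNondegenerateSystem Ψ) :
    ∀ᶠ p : ℕ in atTop, p.Prime → |localFactor Ψ p - 1| ≤ (t : ℝ) ^ 2 / (p : ℝ) ^ 2 := by
  have h1 := eventually_all.mpr fun i => eventually_card_modZero Ψ hΨ i
  have h2 : ∀ᶠ p : ℕ in atTop, ∀ ij ∈ (univ : Finset (Fin t)).offDiag, ∀ [Fact p.Prime],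
      #{v : Fin d → ZMod p | (Ψ ij.1).modEval p v = 0 ∧ (Ψ ij.2).modEval p v = 0} * p ^ 2 ≤
        p ^ d :=
    (eventually_all_finset _).mpr fun ij hij =>
      eventually_card_modZero_pair_le Ψ hΨ (Finset.mem_offDiag.mp hij).2.2
  filter_upwards [h1, h2, eventually_ge_atTop (2 * t), eventually_ge_atTop 2]
    with p h1 h2 hpt hp2 hprime
  haveI := Fact.mk hprime
  have hAp : (∑ i, #{v : Fin d → ZMod p | (Ψ i).modEval p v = 0}) * p = t * p ^ d := by
    rw [Finset.sum_mul, Finset.sum_congr rfl fun i _ => h1 i, Finset.sum_const, Finset.card_univ,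
      Fintype.card_fin, smul_eq_mul]
  have hBp : (∑ ij ∈ (univ : Finset (Fin t)).offDiag,
      #{v : Fin d → ZMod p | (Ψ ij.1).modEval p v = 0 ∧ (Ψ ij.2).modEval p v = 0}) * p ^ 2 ≤
        (t * t - t) * p ^ d := by
    rw [Finset.sum_mul]
    calc _ ≤ ∑ ij ∈ (univ : Finset (Fin t)).offDiag, p ^ d :=
          Finset.sum_le_sum fun ij hij => h2 ij hij
      _ = _ := by
          rw [Finset.sum_const, smul_eq_mul, Finset.offDiag_card, Finset.card_univ,
            Fintype.card_fin]
  -- `goodCount Ψ p + #⋃ Sᵢ = p^d` and the two Bonferroni inequalities (the `∃`/`∀`-filters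
  -- are taken from the lemmas so that their decidability instances agree)
  have hG : goodCount Ψ p + _ = Fintype.card (Fin d → ZMod p) :=
    card_filter_forall_not_add (fun i v => (Ψ i).modEval p v = 0)
  rw [card_zmod_pow p d] at hG
  have hb1 := bonferroni_one (fun i v => (Ψ i).modEval p v = 0)
  have hb2 := bonferroni_two (fun i v => (Ψ i).modEval p v = 0)
  rw [localFactor_prime]
  exact localFactor_estimate hp2 hpt hAp hBp (by omega) (by omega)

/-! ### Convergence of the singular product -/

/-- The factors `β_p` (extended by `1` at non-primes) satisfy `∑ |β_p - 1| < ∞`.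
[cite: GreenTao2010, Lemma 1.3] -/
theorem summable_norm_localFactor_sub_one (Ψ : Fin t → AffLinForm d)
    (hΨ : IsNondegenerateSystem Ψ) :
    Summable fun n : ℕ => ‖(if n.Prime then localFactor Ψ n else 1) - 1‖ := by
  refine Summable.of_norm_bounded_eventually_nat
    ((Real.summable_nat_pow_inv.mpr one_lt_two).mul_left ((t : ℝ) ^ 2)) ?_
  filter_upwards [abs_localFactor_sub_one_le Ψ hΨ] with n hn
  rw [norm_norm, Real.norm_eq_abs]
  split_ifs with h
  · rw [← div_eq_mul_inv]
    exact hn h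
  · rw [sub_self, abs_zero]
    positivity

/-- The singular product is (unconditionally) multipliable. [cite: GreenTao2010, Lemma 1.3] -/
theorem multipliable_localFactor (Ψ : Fin t → AffLinForm d) (hΨ : IsNondegenerateSystem Ψ) :
    Multipliable fun n : ℕ => if n.Prime then localFactor Ψ n else 1 := by
  have := multipliable_one_add_of_summable (summable_norm_localFactor_sub_one Ψ hΨ)
  simpa only [add_sub_cancel] using this

/-- `∏_{p ≤ x} β_p` as a product over `range (x + 1)`. [folklore] -/
theorem singularProductPartial_eq_prod_range (Ψ : Fin t → AffLinForm d) (x : ℕ) :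
    singularProductPartial Ψ x =
      ∏ n ∈ range (x + 1), if n.Prime then localFactor Ψ n else 1 := by
  rw [singularProductPartial, Nat.primesLE_eq_filter_range, Finset.prod_filter]

/-- **Discharge of `tendsto_singularProductPartial`** (Green–Tao 2010, Lemma 1.3 and the sentence
following its proof: "the singular series `∏_p β_p` is always convergent"): for a system
satisfying the standing hypotheses the ordered partial products `∏_{p ≤ x} β_p` converge.
[cite: GreenTao2010, Lemma 1.3] -/
theorem tendsto_singularProductPartial_holds : tendsto_singularProductPartial := by
  intro d t Ψ hΨ
  have hlim : Tendsto (singularProductPartial Ψ) atTop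
      (𝓝 (∏' n : ℕ, if n.Prime then localFactor Ψ n else 1)) := by
    have := (multipliable_localFactor Ψ hΨ).tendsto_prod_tprod_nat.comp (tendsto_add_atTop_nat 1)
    exact this.congr fun x => (singularProductPartial_eq_prod_range Ψ x).symm
  exact tendsto_nhds_limUnder ⟨_, hlim⟩

end Literature.NumberTheory.Sieve
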